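import Summits.QuantumFields.QCD.Theses.HeatSlicedQuarks
import Literature.MathematicalPhysics.QuantumLattice.OverlapLocality
import Literature.MathematicalPhysics.QuantumLattice.LatticeToriProofs
import Literature.MathematicalPhysics.QuantumLattice.LinkHopCommutators
import Literature.MathematicalPhysics.QuantumLattice.WilsonDiracLowerBound
import Literature.Analysis.Matrix.LocalFloorDimensionBound

/-!
# Stub `stub_localModeBudget` of line `low-mode-quarantine`
(crux `Summit.QuantumFields.QCD.Theses.HeatSlicedQuarks.RobustYangMillsHandover`,
item stmt-QuantumFields-8892)

**The quarantine's rank is paid by local action.**  For every `m₀ ∈ (0, 1]` there are `R : ℕ`,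
`C : ℝ` (depending on `m₀` only) such that on every `(ℤ/L)⁴`, for every `SU(3)` field `U`, every
`m ∈ [−1/2, 1]` with `|m| ≥ m₀`, every site set `Z` and every subspace `E` of quark fields
supported in `Z` on which `D = wilsonDirac (fundamentalRep (Fin 3)) U m 1` has
`Σ‖(Dv)_i‖² ≤ (m₀²/4)Σ‖v_i‖²`: `dim E ≤ C · (Σ_{y : dist(y, Z) ≤ R} Σ_{μ,ν} (3 − Re tr U_{μν}(y)) + 1)`.

Proof (IMS localisation of Neuberger's local lower bound; constants generous):
`ε₀ = m₀⁴/28800` (`√(2ε₀) = m₀²/120`), `ℓ = ⌈400/m₀⌉`, `R = 1 + ℓ`, `B = (R + 1)·8(2R + 1)³`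
(a bound for torus balls of radius `R`, `lmb_card_ball_le`), `C = 12B/ε₀`.  A site is ROUGH if a
plaquette based there has trace deficit `> ε₀`; fields supported at torus distance `> 1` from the
rough sites enjoy the local floor `‖Dw‖² ≥ (m² − 30√(2ε₀))‖w‖² ≥ (3m₀²/4)‖w‖²`
(`wilsonDirac_normSq_mulVec_ge_of_plaquette_near_support` +
`norm_one_sub_le_sqrt_two_mul_trace_deficit`; `lmb_localFloor`, both signs of `m`).  `D` has range
one in the sites and off-site absolute row/column sums `≤ 96` (helpers copied from the sibling
stub `stub_highBlockLocality`), so the abstract IMS/Schur bound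
`Literature.Analysis.Matrix.exists_finrank_le_card_of_localFloor` (gap
`2·m₀²/4 + 2(96/ℓ)² < 3m₀²/4`) gives `dim E ≤ 12 · #T`, `T ⊆ {x ∈ Z | ∃ y rough, dist x y < R}`;
finally `#T ≤ B · #{y rough | dist(y, Z) ≤ R}` and each such `y` contributes `> ε₀` to the
collar action (deficits are `≥ 0`, `lmb_traceDeficit_nonneg`).

References: IMS localisation — Cycon–Froese–Kirsch–Simon §3.1; Neuberger, Phys. Rev. D 61 (2000)
085015 [Neuberger2000Bounds]; Schur's test — Horn–Johnson §5.6.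
-/


namespace Summit.QuantumFields.QCD.Cruxes.RobustYangMillsHandover.LowModeQuarantine

open scoped BigOperators Classical Matrix
open Literature.MathematicalPhysics.QuantumFieldTheory
open Literature.MathematicalPhysics.QuantumLattice
open Literature.Probability.LatticeModels (TorusSite)
open Filter Topology

/-- Entries of the (unitary) Euclidean gamma matrices have modulus `≤ 1`.  (Copy of the private
`hbl_norm_euclideanGamma_apply_le` of the sibling stub `stub_highBlockLocality`.) -/
private theorem lmb_norm_euclideanGamma_apply_le (μ : Fin 4) (α β : Fin 4) :
    ‖euclideanGamma μ α β‖ ≤ 1 := by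
  refine entry_norm_bound_of_unitary (Matrix.mem_unitaryGroup_iff'.mpr ?_) α β
  rw [Matrix.star_eq_conjTranspose, (euclideanGamma_isHermitian μ).eq, euclideanGamma_mul_self]

/-- Entries of `r·1 ∓ γ_μ` at `r = 1` have modulus `≤ 2`.  (Copy of the private
`hbl_norm_one_sub_gamma_apply_le`.) -/
private theorem lmb_norm_one_sub_gamma_apply_le (μ : Fin 4) (α β : Fin 4) :
    ‖(((1 : ℝ) : ℂ) • (1 : Matrix (Fin 4) (Fin 4) ℂ) - euclideanGamma μ) α β‖ ≤ 2 ∧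
      ‖(((1 : ℝ) : ℂ) • (1 : Matrix (Fin 4) (Fin 4) ℂ) + euclideanGamma μ) α β‖ ≤ 2 := by
  have h1 : ‖(1 : Matrix (Fin 4) (Fin 4) ℂ) α β‖ ≤ 1 := by
    rw [Matrix.one_apply]; split_ifs <;> simp
  have h2 := lmb_norm_euclideanGamma_apply_le μ α β
  simp only [Complex.ofReal_one, one_smul, Matrix.sub_apply, Matrix.add_apply]
  exact ⟨(norm_sub_le _ _).trans (by linarith), (norm_add_le _ _).trans (by linarith)⟩

variable {L : ℕ} [NeZero L]

omit [NeZero L] in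
/-- Off the diagonal, `|D_{pq}| ≤ Σ_μ (𝟙[q = p + μ̂] + 𝟙[p = q + μ̂])` (site components; one
forward and one backward hop per direction, each of modulus `≤ ½ · 2 · 1`).  (Copy of the
private `hbl_norm_wilsonDirac_apply_le`.) -/
private theorem lmb_norm_wilsonDirac_apply_le
    (U : GaugeConfig 4 L ↥(Matrix.specialUnitaryGroup (Fin 3) ℂ)) (m : ℝ)
    {p q : TorusSite 4 L × Fin 3 × Fin 4} (hpq : p ≠ q) :
    ‖wilsonDirac (fundamentalRep (Fin 3)) U m 1 p q‖ ≤
      ∑ μ : Fin 4, ((if q.1 = Site.shift p.1 μ then (1 : ℝ) else 0) +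
        (if p.1 = Site.shift q.1 μ then (1 : ℝ) else 0)) := by
  have hU : ∀ g : ↥(Matrix.specialUnitaryGroup (Fin 3) ℂ), ∀ a b : Fin 3,
      ‖fundamentalRep (Fin 3) g a b‖ ≤ 1 := fun g a b =>
    entry_norm_bound_of_unitary (fundamentalRep_mem_unitaryGroup g) a b
  simp only [wilsonDirac, Matrix.of_apply, if_neg hpq, zero_sub, norm_neg, norm_mul]
  have hhalf : ‖(1 / 2 : ℂ)‖ = 1 / 2 := by norm_num
  rw [hhalf]
  have hterm : ∀ μ : Fin 4,
      ‖(if q.1 = Site.shift p.1 μ then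
            (((1 : ℝ) : ℂ) • (1 : Matrix (Fin 4) (Fin 4) ℂ) - euclideanGamma μ) p.2.2 q.2.2 *
              fundamentalRep (Fin 3) (U (p.1, μ)) p.2.1 q.2.1 else 0) +
          (if p.1 = Site.shift q.1 μ then
            (((1 : ℝ) : ℂ) • (1 : Matrix (Fin 4) (Fin 4) ℂ) + euclideanGamma μ) p.2.2 q.2.2 *
              fundamentalRep (Fin 3) (U (q.1, μ))⁻¹ p.2.1 q.2.1 else 0)‖ ≤
        2 * ((if q.1 = Site.shift p.1 μ then (1 : ℝ) else 0) +
          (if p.1 = Site.shift q.1 μ then (1 : ℝ) else 0)) := by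
    intro μ
    obtain ⟨hm, hp⟩ := lmb_norm_one_sub_gamma_apply_le μ p.2.2 q.2.2
    refine (norm_add_le _ _).trans ?_
    rw [mul_add]
    refine add_le_add ?_ ?_
    · split_ifs with hc
      · rw [norm_mul]
        calc _ ≤ 2 * 1 := mul_le_mul hm (hU _ _ _) (norm_nonneg _) zero_le_two
          _ = 2 * 1 := rfl
      · simp
    · split_ifs with hc
      · rw [norm_mul]
        calc _ ≤ 2 * 1 := mul_le_mul hp (hU _ _ _) (norm_nonneg _) zero_le_two
          _ = 2 * 1 := rfl
      · simp
  calc 1 / 2 * ‖∑ μ : Fin 4, _‖ ≤ 1 / 2 * ∑ μ : Fin 4,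
        2 * ((if q.1 = Site.shift p.1 μ then (1 : ℝ) else 0) +
          (if p.1 = Site.shift q.1 μ then (1 : ℝ) else 0)) := by
        refine mul_le_mul_of_nonneg_left
          ((norm_sum_le _ _).trans (Finset.sum_le_sum fun μ _ => hterm μ)) ?_
        norm_num
    _ = _ := by rw [← Finset.mul_sum]; ring

/-- **Range one**: `D_{pq} ≠ 0` forces `torusDist p q ≤ 1` (site components).  (Copy of the
private `hbl_wilsonDirac_range`.) -/
private theorem lmb_wilsonDirac_range
    (U : GaugeConfig 4 L ↥(Matrix.specialUnitaryGroup (Fin 3) ℂ)) (m : ℝ)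
    (p q : TorusSite 4 L × Fin 3 × Fin 4)
    (h : wilsonDirac (fundamentalRep (Fin 3)) U m 1 p q ≠ 0) : torusDist p.1 q.1 ≤ 1 := by
  by_contra hd
  rw [not_le] at hd
  have hpq : p ≠ q := by
    rintro rfl
    rw [torusDist_self] at hd
    exact Nat.not_succ_le_zero 1 hd
  have h1 : ∀ μ : Fin 4, ¬ q.1 = Site.shift p.1 μ := by
    intro μ hq
    have := torusDist_add_single_le_one p.1 μ
    rw [torusDist_comm', ← Site.shift, ← hq] at this
    omega
  have h2 : ∀ μ : Fin 4, ¬ p.1 = Site.shift q.1 μ := by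
    intro μ hp
    have := torusDist_add_single_le_one q.1 μ
    rw [← Site.shift, ← hp] at this
    omega
  have hle := lmb_norm_wilsonDirac_apply_le U m hpq
  simp only [if_neg (h1 _), if_neg (h2 _), add_zero, Finset.sum_const_zero] at hle
  exact h (norm_le_zero_iff.mp hle)

/-- Counting: `#{(y, b, β) | y = s} = 12`.  (Copy of the private `hbl_sum_ite_fst_eq`.) -/
private theorem lmb_sum_ite_fst_eq (s : TorusSite 4 L) :
    ∑ q : TorusSite 4 L × Fin 3 × Fin 4, (if q.1 = s then (1 : ℝ) else 0) = 12 := by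
  rw [Fintype.sum_prod_type, Finset.sum_eq_single s (fun y _ hy => by simp [hy]) (by simp)]
  simp only [if_true, Finset.sum_const, Finset.card_univ, Fintype.card_prod, Fintype.card_fin,
    nsmul_eq_mul, mul_one]
  norm_num

/-- Counting the hops at a site: `Σ_q Σ_μ (𝟙[q = s + μ̂] + 𝟙[s = q + μ̂]) = 96`. -/
private theorem lmb_sum_hops_eq (s : TorusSite 4 L) :
    ∑ q : TorusSite 4 L × Fin 3 × Fin 4, ∑ μ : Fin 4, ((if q.1 = Site.shift s μ then (1 : ℝ) else 0) +
      (if s = Site.shift q.1 μ then (1 : ℝ) else 0)) = 96 := by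
  rw [Finset.sum_comm]
  calc _ = ∑ _μ : Fin 4, ((12 : ℝ) + 12) := by
        refine Finset.sum_congr rfl fun μ _ => ?_
        rw [Finset.sum_add_distrib, lmb_sum_ite_fst_eq]
        simp_rw [eq_shift_iff s _ μ]
        rw [lmb_sum_ite_fst_eq]
    _ = 96 := by norm_num

/-- **Row sums**: `Σ_{q : dist(p,q) ≠ 0} |D_{pq}| ≤ 96` (cf. the private
`hbl_wilsonDirac_rowSum_le`). -/
private theorem lmb_wilsonDirac_rowSum_le
    (U : GaugeConfig 4 L ↥(Matrix.specialUnitaryGroup (Fin 3) ℂ)) (m : ℝ)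
    (p : TorusSite 4 L × Fin 3 × Fin 4) :
    ∑ q ∈ Finset.univ.filter (fun q : TorusSite 4 L × Fin 3 × Fin 4 => torusDist p.1 q.1 ≠ 0),
      ‖wilsonDirac (fundamentalRep (Fin 3)) U m 1 p q‖ ≤ 96 := by
  calc _ ≤ ∑ q ∈ Finset.univ.filter
          (fun q : TorusSite 4 L × Fin 3 × Fin 4 => torusDist p.1 q.1 ≠ 0),
        ∑ μ : Fin 4, ((if q.1 = Site.shift p.1 μ then (1 : ℝ) else 0) +
          (if p.1 = Site.shift q.1 μ then (1 : ℝ) else 0)) := by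
        refine Finset.sum_le_sum fun q hq => lmb_norm_wilsonDirac_apply_le U m ?_
        rintro rfl
        rw [Finset.mem_filter, torusDist_self] at hq
        exact hq.2 rfl
    _ ≤ _ := Finset.sum_le_univ_sum_of_nonneg fun q => Finset.sum_nonneg fun μ _ => by positivity
    _ = 96 := lmb_sum_hops_eq p.1

/-- **Column sums**: `Σ_{p : dist(p,q) ≠ 0} |D_{pq}| ≤ 96` (cf. the private
`hbl_wilsonDirac_colSum_le`). -/
private theorem lmb_wilsonDirac_colSum_le
    (U : GaugeConfig 4 L ↥(Matrix.specialUnitaryGroup (Fin 3) ℂ)) (m : ℝ)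
    (q : TorusSite 4 L × Fin 3 × Fin 4) :
    ∑ p ∈ Finset.univ.filter (fun p : TorusSite 4 L × Fin 3 × Fin 4 => torusDist p.1 q.1 ≠ 0),
      ‖wilsonDirac (fundamentalRep (Fin 3)) U m 1 p q‖ ≤ 96 := by
  calc _ ≤ ∑ p ∈ Finset.univ.filter
          (fun p : TorusSite 4 L × Fin 3 × Fin 4 => torusDist p.1 q.1 ≠ 0),
        ∑ μ : Fin 4, ((if p.1 = Site.shift q.1 μ then (1 : ℝ) else 0) +
          (if q.1 = Site.shift p.1 μ then (1 : ℝ) else 0)) := by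
        refine Finset.sum_le_sum fun p hp => (lmb_norm_wilsonDirac_apply_le U m ?_).trans
          (le_of_eq (Finset.sum_congr rfl fun μ _ => add_comm _ _))
        rintro rfl
        rw [Finset.mem_filter, torusDist_self] at hp
        exact hp.2 rfl
    _ ≤ _ := Finset.sum_le_univ_sum_of_nonneg fun p => Finset.sum_nonneg fun μ _ => by positivity
    _ = 96 := lmb_sum_hops_eq q.1

omit [NeZero L] in
/-- Plaquette deficits are non-negative: `Re tr u ≤ 3` for `u ∈ SU(3)` (`|u_aa| ≤ 1`). -/
private theorem lmb_traceDeficit_nonneg (g : ↥(Matrix.specialUnitaryGroup (Fin 3) ℂ)) :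
    0 ≤ 3 - ((fundamentalRep (Fin 3) g).trace).re := by
  have hu := fundamentalRep_mem_unitaryGroup g
  have h1 : ((fundamentalRep (Fin 3) g).trace).re ≤ 3 := by
    rw [Matrix.trace, Complex.re_sum]
    calc ∑ a, ((fundamentalRep (Fin 3) g).diag a).re ≤ ∑ _a : Fin 3, (1 : ℝ) :=
          Finset.sum_le_sum fun a _ =>
            (Complex.re_le_norm _).trans (entry_norm_bound_of_unitary hu a a)
      _ = 3 := by simp
  linarith

/-- Torus balls: `#{x | torusDist x y ≤ R} ≤ (R + 1) · 8(2R + 1)³` (union of spheres). -/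
private theorem lmb_card_ball_le (y : TorusSite 4 L) (R : ℕ) :
    (Finset.univ.filter fun x : TorusSite 4 L => torusDist x y ≤ R).card ≤
      (R + 1) * (8 * (2 * R + 1) ^ 3) := by
  have hsub : (Finset.univ.filter fun x : TorusSite 4 L => torusDist x y ≤ R) ⊆
      (Finset.range (R + 1)).biUnion
        (fun r => Finset.univ.filter fun x : TorusSite 4 L => torusDist x y = r) := by
    intro x hx
    simp only [Finset.mem_filter, Finset.mem_univ, true_and] at hx
    simp only [Finset.mem_biUnion, Finset.mem_range, Finset.mem_filter, Finset.mem_univ, true_and]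
    exact ⟨torusDist x y, Nat.lt_succ_of_le hx, rfl⟩
  calc _ ≤ _ := Finset.card_le_card hsub
    _ ≤ ∑ r ∈ Finset.range (R + 1),
          (Finset.univ.filter fun x : TorusSite 4 L => torusDist x y = r).card :=
        Finset.card_biUnion_le
    _ ≤ ∑ _r ∈ Finset.range (R + 1), 8 * (2 * R + 1) ^ 3 := by
        refine Finset.sum_le_sum fun r hr => ?_
        have hr' : r ≤ R := Nat.lt_succ_iff.mp (Finset.mem_range.mp hr)
        have h3 : (2 * r + 1) ^ 3 ≤ (2 * R + 1) ^ 3 := Nat.pow_le_pow_left (by omega) 3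
        calc _ ≤ 4 * (2 * (2 * r + 1) ^ (4 - 1)) := card_filter_torusDist_eq_le (by norm_num) y r
          _ = 8 * (2 * r + 1) ^ 3 := by norm_num; ring
          _ ≤ 8 * (2 * R + 1) ^ 3 := Nat.mul_le_mul_left 8 h3
    _ = (R + 1) * (8 * (2 * R + 1) ^ 3) := by
        rw [Finset.sum_const, Finset.card_range, smul_eq_mul]

open scoped Matrix.Norms.L2Operator in
/-- **The local floor** (Neuberger's local bound + trace-deficit conversion): if `|m| ≥ m₀ > 0`,
`m ≥ −1`, and every site of `w` is at torus distance `> 1` from every site carrying a plaquette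
of deficit `> ε₀`, then `(m₀² − 30√(2ε₀)) Σ‖w_p‖² ≤ Σ‖(D_W(U, m, 1) w)_p‖²`. -/
private theorem lmb_localFloor (U : GaugeConfig 4 L ↥(Matrix.specialUnitaryGroup (Fin 3) ℂ))
    {m₀ m ε₀ : ℝ} (hm₀ : 0 < m₀) (hm : -1 ≤ m) (hm₀m : m₀ ≤ |m|)
    (w : TorusSite 4 L × Fin 3 × Fin 4 → ℂ)
    (hw : ∀ p, w p ≠ 0 → ∀ y : TorusSite 4 L,
      (∃ μ ν : Fin 4,
        ε₀ < 3 - ((fundamentalRep (Fin 3) (plaquetteHolonomy U y μ ν)).trace).re) →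
        1 < torusDist p.1 y) :
    (m₀ ^ 2 - 30 * Real.sqrt (2 * ε₀)) * ∑ p, ‖w p‖ ^ 2 ≤
      ∑ p, ‖(wilsonDirac (fundamentalRep (Fin 3)) U m 1 *ᵥ w) p‖ ^ 2 := by
  set δ : ℝ := Real.sqrt (2 * ε₀) with hδ_def
  have hδ : 0 ≤ δ := Real.sqrt_nonneg _
  have hplaq : ∀ y : TorusSite 4 L,
      (∃ x : TorusSite 4 L, (∃ a α, w (x, a, α) ≠ 0) ∧ torusDist x y ≤ 1) →
        ∀ μ ν : Fin 4, μ ≠ ν →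
          ‖(1 : Matrix (Fin 3) (Fin 3) ℂ) - fundamentalRep (Fin 3) (plaquetteHolonomy U y μ ν)‖ ≤
            δ := by
    rintro y ⟨x, ⟨a, α, hxa⟩, hxy⟩ μ ν _
    have hle : 3 - ((fundamentalRep (Fin 3) (plaquetteHolonomy U y μ ν)).trace).re ≤ ε₀ := by
      by_contra hlt
      exact absurd (hw (x, a, α) hxa y ⟨μ, ν, not_le.mp hlt⟩) (not_lt.mpr hxy)
    refine (norm_one_sub_le_sqrt_two_mul_trace_deficit _
      (fundamentalRep_mem_unitaryGroup _)).trans ?_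
    refine Real.sqrt_le_sqrt ?_
    push_cast
    linarith
  have hA := wilsonDirac_normSq_mulVec_ge_of_plaquette_near_support (fundamentalRep (Fin 3))
    fundamentalRep_mem_unitaryGroup U m hm δ hδ w hplaq
  have hsum : 0 ≤ ∑ p, ‖w p‖ ^ 2 := Finset.sum_nonneg fun p _ => by positivity
  have hm2 : m₀ ^ 2 ≤ m ^ 2 := by
    rw [← sq_abs m]
    exact pow_le_pow_left₀ hm₀.le hm₀m 2
  exact (mul_le_mul_of_nonneg_right (by linarith) hsum).trans hA

/-- **stub_localModeBudget — the quarantine's rank is paid by local action** (registered stub of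
line `low-mode-quarantine`): for `m₀ ∈ (0, 1]`, with `R = 1 + ⌈400/m₀⌉` and
`C = 12 (R + 1) 8 (2R + 1)³ · 28800/m₀⁴`, every subspace `E` of quark fields supported in `Z` with
`Σ‖(D_W v)_i‖² ≤ (m₀²/4) Σ‖v_i‖²` on `E` (`|m| ≥ m₀`, `m ∈ [−1/2, 1]`, any `SU(3)` field, any `L`)
has `dim E ≤ C · (Σ_{y : ∃ z ∈ Z, torusDist y z ≤ R} Σ_{μ,ν} (3 − Re tr U_{μν}(y)) + 1)`.  IMS
localisation (`Literature.Analysis.Matrix.exists_finrank_le_card_of_localFloor`) of Neuberger's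
local lower bound [Neuberger2000Bounds, §Lower bound]. -/
theorem stub_localModeBudget :
    ∀ m₀ : ℝ, 0 < m₀ → m₀ ≤ 1 → ∃ (R : ℕ) (C : ℝ),
      ∀ (L : ℕ) [NeZero L] (U : GaugeConfig 4 L (Matrix.specialUnitaryGroup (Fin 3) ℂ)) (m : ℝ),
        m ∈ Set.Icc (-(1 / 2 : ℝ)) 1 → m₀ ≤ |m| →
        ∀ (Z : Finset (TorusSite 4 L)) (E : Submodule ℂ (TorusSite 4 L × Fin 3 × Fin 4 → ℂ)),
          (∀ v ∈ E, ∀ x ∉ Z, ∀ (a : Fin 3) (α : Fin 4), v (x, a, α) = 0) →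
          (∀ v ∈ E, ∑ i, ‖(wilsonDirac (fundamentalRep (Fin 3)) U m 1).mulVec v i‖ ^ 2 ≤
              m₀ ^ 2 / 4 * ∑ i, ‖v i‖ ^ 2) →
            (Module.finrank ℂ E : ℝ) ≤ C * ((∑ y ∈ Finset.univ.filter
                (fun y : TorusSite 4 L => ∃ z ∈ Z, torusDist y z ≤ R),
              ∑ μ : Fin 4, ∑ ν : Fin 4,
                (3 - ((fundamentalRep (Fin 3) (plaquetteHolonomy U y μ ν)).trace).re)) + 1) := by
  intro m₀ hm₀ _hm₀1
  -- constants depending on `m₀` only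
  obtain ⟨ε₀, hε₀_def⟩ : ∃ ε₀ : ℝ, ε₀ = m₀ ^ 4 / 28800 := ⟨_, rfl⟩
  have hε₀ : 0 < ε₀ := by rw [hε₀_def]; positivity
  obtain ⟨ℓ, hℓ_def⟩ : ∃ ℓ : ℕ, ℓ = ⌈400 / m₀⌉₊ := ⟨_, rfl⟩
  have hℓ : 0 < ℓ := by rw [hℓ_def]; exact Nat.ceil_pos.mpr (by positivity)
  have hℓge : 400 / m₀ ≤ (ℓ : ℝ) := by rw [hℓ_def]; exact Nat.le_ceil _
  obtain ⟨R, hR_def⟩ : ∃ R : ℕ, R = 1 + ℓ := ⟨_, rfl⟩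
  obtain ⟨B, hB_def⟩ : ∃ B : ℕ, B = (R + 1) * (8 * (2 * R + 1) ^ 3) := ⟨_, rfl⟩
  refine ⟨R, 12 * B / ε₀, ?_⟩
  intro L _ U m hm hm₀m Z E hEZ hEτ
  -- the numerical gap `2·(m₀²/4) + 2(96/ℓ)² < m₀² − 30√(2ε₀) = 3m₀²/4`
  have hδeq : Real.sqrt (2 * ε₀) = m₀ ^ 2 / 120 := by
    rw [hε₀_def, show 2 * (m₀ ^ 4 / 28800) = (m₀ ^ 2 / 120) ^ 2 by ring,
      Real.sqrt_sq (by positivity)]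
  have hgap : 2 * (m₀ ^ 2 / 4) + 2 * ((96 : ℝ) / ℓ) ^ 2 < m₀ ^ 2 - 30 * Real.sqrt (2 * ε₀) := by
    rw [hδeq]
    have hℓpos : (0 : ℝ) < ℓ := by exact_mod_cast hℓ
    have hq : (96 : ℝ) / ℓ ≤ 96 * m₀ / 400 := by
      rw [div_le_iff₀ hℓpos]
      calc (96 : ℝ) = 96 * m₀ / 400 * (400 / m₀) := by field_simp
        _ ≤ 96 * m₀ / 400 * ℓ := mul_le_mul_of_nonneg_left hℓge (by positivity)
    have hq0 : (0 : ℝ) ≤ 96 / ℓ := by positivity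
    have hq2 : ((96 : ℝ) / ℓ) ^ 2 ≤ (96 * m₀ / 400) ^ 2 := pow_le_pow_left₀ hq0 hq 2
    nlinarith [pow_pos hm₀ 2]
  -- deficits, rough sites, the local floor
  obtain ⟨df, hdf⟩ : ∃ df : TorusSite 4 L → Fin 4 → Fin 4 → ℝ,
      df = fun y μ ν => 3 - ((fundamentalRep (Fin 3) (plaquetteHolonomy U y μ ν)).trace).re :=
    ⟨_, rfl⟩
  have hdf0 : ∀ y μ ν, 0 ≤ df y μ ν := fun y μ ν => by rw [hdf]; exact lmb_traceDeficit_nonneg _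
  obtain ⟨rough, hrough⟩ : ∃ rough : TorusSite 4 L → Prop,
      rough = fun y => ∃ μ ν : Fin 4, ε₀ < df y μ ν := ⟨_, rfl⟩
  have hfloor : ∀ w : TorusSite 4 L × Fin 3 × Fin 4 → ℂ,
      (∀ p, w p ≠ 0 → ∀ y, rough y → 1 < torusDist p.1 y) →
        (m₀ ^ 2 - 30 * Real.sqrt (2 * ε₀)) * ∑ p, ‖w p‖ ^ 2 ≤
          ∑ p, ‖(wilsonDirac (fundamentalRep (Fin 3)) U m 1 *ᵥ w) p‖ ^ 2 := fun w hw =>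
    lmb_localFloor U hm₀ (by linarith [hm.1]) hm₀m w fun p hp y hy =>
      hw p hp y (by rw [hrough, hdf]; exact hy)
  -- the abstract IMS/Schur dimension bound
  obtain ⟨T, hT, hfin⟩ := Literature.Analysis.Matrix.exists_finrank_le_card_of_localFloor
    (fun x y : TorusSite 4 L => torusDist x y) (fun x y => torusDist_comm' x y)
    (fun x y z => torusDist_triangle' x y z) (wilsonDirac (fundamentalRep (Fin 3)) U m 1)
    (fun p q hpq => lmb_wilsonDirac_range U m p q hpq) 96 (by norm_num)
    (lmb_wilsonDirac_rowSum_le U m) (lmb_wilsonDirac_colSum_le U m) rough 1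
    (m₀ ^ 2 - 30 * Real.sqrt (2 * ε₀)) (m₀ ^ 2 / 4) ℓ hℓ hgap hfloor Z E
    (fun v hv x hx k => hEZ v hv x hx k.1 k.2) hEτ
  -- counting: `T ⊆ ⋃_{y ∈ RZ} ball(y, R)` with `RZ` the rough sites within `R` of `Z`
  obtain ⟨RZ, hRZ⟩ : ∃ RZ : Finset (TorusSite 4 L), RZ = Finset.univ.filter
      (fun y : TorusSite 4 L => rough y ∧ ∃ z ∈ Z, torusDist y z ≤ R) := ⟨_, rfl⟩
  have hTsub : T ⊆ RZ.biUnion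
      (fun y => Finset.univ.filter fun x : TorusSite 4 L => torusDist x y ≤ R) := by
    intro x hx
    obtain ⟨hxZ, y, hy, hxy⟩ := hT x hx
    have hxy' : torusDist x y ≤ R := by
      have h' : torusDist x y < 1 + ℓ := hxy
      omega
    refine Finset.mem_biUnion.mpr ⟨y, ?_, Finset.mem_filter.mpr ⟨Finset.mem_univ _, hxy'⟩⟩
    rw [hRZ, Finset.mem_filter]
    exact ⟨Finset.mem_univ _, hy, x, hxZ, by rw [torusDist_comm']; exact hxy'⟩
  have hTcard : T.card ≤ RZ.card * B := by
    calc T.card ≤ _ := Finset.card_le_card hTsub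
      _ ≤ ∑ y ∈ RZ, (Finset.univ.filter fun x : TorusSite 4 L => torusDist x y ≤ R).card :=
          Finset.card_biUnion_le
      _ ≤ ∑ _y ∈ RZ, B := Finset.sum_le_sum fun y _ => hB_def ▸ lmb_card_ball_le y R
      _ = RZ.card * B := by rw [Finset.sum_const, smul_eq_mul]
  -- every `y ∈ RZ` carries more than `ε₀` of collar action
  obtain ⟨S, hS⟩ : ∃ S : ℝ, S = ∑ y ∈ Finset.univ.filter
      (fun y : TorusSite 4 L => ∃ z ∈ Z, torusDist y z ≤ R), ∑ μ : Fin 4, ∑ ν : Fin 4, df y μ ν :=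
    ⟨_, rfl⟩
  rw [show (∑ y ∈ Finset.univ.filter (fun y : TorusSite 4 L => ∃ z ∈ Z, torusDist y z ≤ R),
    ∑ μ : Fin 4, ∑ ν : Fin 4, (3 - ((fundamentalRep (Fin 3) (plaquetteHolonomy U y μ ν)).trace).re))
      = S by rw [hS, hdf]]
  have hS0 : 0 ≤ S :=
    hS ▸ Finset.sum_nonneg fun y _ => Finset.sum_nonneg fun μ _ =>
      Finset.sum_nonneg fun ν _ => hdf0 y μ ν
  have hRZε : ε₀ * RZ.card ≤ S := by
    calc ε₀ * RZ.card = ∑ _y ∈ RZ, ε₀ := by rw [Finset.sum_const, nsmul_eq_mul, mul_comm]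
      _ ≤ ∑ y ∈ RZ, ∑ μ : Fin 4, ∑ ν : Fin 4, df y μ ν := by
          refine Finset.sum_le_sum fun y hy => ?_
          rw [hRZ, Finset.mem_filter, hrough] at hy
          obtain ⟨-, ⟨μ₀, ν₀, hμν⟩, -⟩ := hy
          exact hμν.le.trans ((Finset.single_le_sum (f := fun ν => df y μ₀ ν)
            (fun ν _ => hdf0 y μ₀ ν) (Finset.mem_univ ν₀)).trans
              (Finset.single_le_sum (f := fun μ => ∑ ν, df y μ ν)
                (fun μ _ => Finset.sum_nonneg fun ν _ => hdf0 y μ ν) (Finset.mem_univ μ₀)))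
      _ ≤ S := by
          rw [hS]
          refine Finset.sum_le_sum_of_subset_of_nonneg (fun y hy => ?_) fun y _ _ =>
            Finset.sum_nonneg fun μ _ => Finset.sum_nonneg fun ν _ => hdf0 y μ ν
          rw [hRZ, Finset.mem_filter] at hy
          exact Finset.mem_filter.mpr ⟨Finset.mem_univ _, hy.2.2⟩
  -- assembling the real inequalities
  have h1 : (Module.finrank ℂ E : ℝ) ≤ 12 * (T.card : ℝ) := by
    rw [Fintype.card_prod, Fintype.card_fin, Fintype.card_fin] at hfin
    exact_mod_cast hfin
  have h2 : (T.card : ℝ) ≤ RZ.card * B := by exact_mod_cast hTcard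
  have h3 : (RZ.card : ℝ) * B ≤ S / ε₀ * B :=
    mul_le_mul_of_nonneg_right (by rw [le_div_iff₀ hε₀, mul_comm]; exact hRZε) (Nat.cast_nonneg _)
  have hC : 0 ≤ 12 * (B : ℝ) / ε₀ := by positivity
  calc (Module.finrank ℂ E : ℝ) ≤ 12 * (S / ε₀ * B) := by linarith
    _ = 12 * B / ε₀ * S := by ring
    _ ≤ 12 * B / ε₀ * (S + 1) := mul_le_mul_of_nonneg_left (by linarith) hC

end Summit.QuantumFields.QCD.Cruxes.RobustYangMillsHandover.LowModeQuarantine
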